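import Literature.Analysis.Calculus.TrapezoidVector
import Mathlib.Analysis.SpecialFunctions.Complex.LogDeriv
import HarnessLib

/-!
# Sums `Σᵢ log(κ + i/n)` off the real axis: first-order Euler–Maclaurin with an explicit error

Topic `Literature/Analysis/SpecialFunctions`. Everything here is PROVED; no definitions, no named
facts.

For a complex `κ` with `|im κ| ≥ δ > 0` the function `x ↦ log(κ + x)` (principal branch) is smooth
on `ℝ` with second derivative `−1/(κ + x)²` of norm `≤ 1/δ²`, and `z log z − z` is a primitive
of `log z` on the slit plane. The composite trapezoid rule
(`Literature.Analysis.Calculus.norm_trapezoid_sum_le`) therefore gives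

* `integral_log_add_eq` — `∫_a^b log(κ + x) dx = L(κ + b) − L(κ + a)`, `L(z) = z log z − z`;
* `norm_sum_log_sub_le` —
  `‖Σ_{i=0}^{N} log(κ + (A+i)/n) − ½(log(κ + A/n) + log(κ + (A+N)/n)) − n ∫_{A/n}^{(A+N)/n} log(κ+x) dx‖
   ≤ N/(12 n² δ²)`,

i.e. `Σ_{i=A}^{A+N} log(κ + i/n) = n [L(κ + (A+N)/n) − L(κ + A/n)] + ½(first + last) + O(N/n²)`
uniformly in `|im κ| ≥ δ`. This is the elementary substitute for Stirling's formula in the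
evaluation of products `∏ (k ± i)` at `k = nκ` (the "gamma factors" of very-well-poised
hypergeometric sums, e.g. [Zudilin, Izv. Math. 66 (2002), §4 Lemma 3]) with an error that is
uniform on compact subsets of the open upper half-plane. Folklore.
-/

noncomputable section

open Set MeasureTheory intervalIntegral Finset Complex

namespace Literature.Analysis.SpecialFunctions

/-- `z log z − z` is a primitive of `log z` on the slit plane. [folklore] -/
theorem hasDerivAt_mul_log_sub_self {z : ℂ} (hz : z ∈ slitPlane) :
    HasDerivAt (fun w : ℂ ↦ w * log w - w) (log z) z := by
  have h1 : HasDerivAt (fun w : ℂ ↦ w * log w) (1 * log z + z * z⁻¹) z :=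
    (hasDerivAt_id z).mul (Complex.hasDerivAt_log hz)
  refine (h1.sub (hasDerivAt_id z)).congr_deriv ?_
  have hz0 : z ≠ 0 := slitPlane_ne_zero hz
  field_simp
  ring

/-- If `im κ ≠ 0` then `κ + x ∈ slitPlane` for every real `x`. [folklore] -/
theorem add_ofReal_mem_slitPlane {κ : ℂ} (hκ : κ.im ≠ 0) (x : ℝ) : κ + x ∈ slitPlane :=
  Or.inr (by simpa using hκ)

/-- `d/dx log(κ + x) = 1/(κ + x)` for real `x`, `im κ ≠ 0`. [folklore] -/
theorem hasDerivAt_log_add_ofReal {κ : ℂ} (hκ : κ.im ≠ 0) (x : ℝ) :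
    HasDerivAt (fun t : ℝ ↦ log (κ + t)) ((κ + x)⁻¹) x := by
  have h : HasDerivAt (fun w : ℂ ↦ log (κ + w)) ((κ + x)⁻¹ * 1) (x : ℂ) :=
    (Complex.hasDerivAt_log (add_ofReal_mem_slitPlane hκ x)).comp (x : ℂ)
      ((hasDerivAt_id (x : ℂ)).const_add κ)
  simpa using h.comp_ofReal

/-- `d/dx (κ + x)⁻¹ = −1/(κ + x)²` for real `x`, `im κ ≠ 0`. [folklore] -/
theorem hasDerivAt_inv_add_ofReal {κ : ℂ} (hκ : κ.im ≠ 0) (x : ℝ) :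
    HasDerivAt (fun t : ℝ ↦ (κ + t)⁻¹) (-((κ + x) ^ 2)⁻¹) x := by
  have hne : κ + x ≠ 0 := slitPlane_ne_zero (add_ofReal_mem_slitPlane hκ x)
  have h : HasDerivAt (fun w : ℂ ↦ (κ + w)⁻¹) (-(1 : ℂ) / (κ + x) ^ 2) (x : ℂ) := by
    simpa using ((hasDerivAt_id (x : ℂ)).const_add κ).fun_inv hne
  have := h.comp_ofReal
  simpa [neg_div] using this

/-- `d/dx (L(κ + x)) = log(κ + x)` with `L(z) = z log z − z`, for real `x`, `im κ ≠ 0`. [folklore] -/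
theorem hasDerivAt_primitive_log_add_ofReal {κ : ℂ} (hκ : κ.im ≠ 0) (x : ℝ) :
    HasDerivAt (fun t : ℝ ↦ (κ + t) * log (κ + t) - (κ + t)) (log (κ + x)) x := by
  have h : HasDerivAt (fun w : ℂ ↦ (κ + w) * log (κ + w) - (κ + w)) (log (κ + x) * 1) (x : ℂ) :=
    (hasDerivAt_mul_log_sub_self (add_ofReal_mem_slitPlane hκ x)).comp (x : ℂ)
      ((hasDerivAt_id (x : ℂ)).const_add κ)
  simpa using h.comp_ofReal

/-- **`∫_a^b log(κ + x) dx = L(κ + b) − L(κ + a)`**, `L(z) = z log z − z`, when `im κ ≠ 0`.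
[folklore] -/
theorem integral_log_add_eq {κ : ℂ} (hκ : κ.im ≠ 0) (a b : ℝ) :
    ∫ x in a..b, log (κ + x) =
      ((κ + b) * log (κ + b) - (κ + b)) - ((κ + a) * log (κ + a) - (κ + a)) := by
  refine integral_eq_sub_of_hasDerivAt (fun x _ ↦ hasDerivAt_primitive_log_add_ofReal hκ x) ?_
  refine ContinuousOn.intervalIntegrable fun x _ ↦ ?_
  exact (hasDerivAt_log_add_ofReal hκ x).continuousAt.continuousWithinAt

/-- `‖(κ + x)⁻²‖ ≤ 1/δ²` when `|im κ| ≥ δ > 0`. [folklore] -/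
theorem norm_inv_sq_add_ofReal_le {κ : ℂ} {δ : ℝ} (hδ : 0 < δ) (hκ : δ ≤ |κ.im|) (x : ℝ) :
    ‖-((κ + x) ^ 2)⁻¹‖ ≤ 1 / δ ^ 2 := by
  rw [norm_neg, norm_inv, norm_pow, one_div]
  refine inv_anti₀ (by positivity) ?_
  have h : δ ≤ ‖κ + x‖ := by
    refine hκ.trans ?_
    have := abs_im_le_norm (κ + x)
    simpa using this
  exact pow_le_pow_left₀ hδ.le h 2

/-- **First-order Euler–Maclaurin for `Σ log(κ + i/n)` off the real axis.** For `|im κ| ≥ δ > 0`,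
`n ≥ 1`, an integer `A` and `N : ℕ`:
`‖Σ_{i=0}^{N} log(κ + (A+i)/n) − ½ (log(κ + A/n) + log(κ + (A+N)/n))
  − n ∫_{A/n}^{(A+N)/n} log(κ + x) dx‖ ≤ N / (12 n² δ²)`. [folklore] -/
theorem norm_sum_log_sub_le {κ : ℂ} {δ : ℝ} (hδ : 0 < δ) (hκ : δ ≤ |κ.im|) {n : ℕ} (hn : 0 < n)
    (A : ℤ) (N : ℕ) :
    ‖(∑ i ∈ range (N + 1), log (κ + (((A : ℝ) + i) / n : ℝ))) -
        (1 / 2 : ℂ) * (log (κ + ((A : ℝ) / n : ℝ)) + log (κ + (((A : ℝ) + N) / n : ℝ))) -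
        (n : ℂ) * ∫ x in ((A : ℝ) / n)..(((A : ℝ) + N) / n), log (κ + x)‖ ≤
      N / (12 * (n : ℝ) ^ 2 * δ ^ 2) := by
  have hκ0 : κ.im ≠ 0 := by
    intro h0; rw [h0, abs_zero] at hκ; linarith
  have hn' : (0 : ℝ) < n := by exact_mod_cast hn
  set a : ℝ := (A : ℝ) / n with ha
  set h : ℝ := 1 / n with hh
  have hh0 : 0 ≤ h := by rw [hh]; positivity
  have hne : ∀ t : ℝ, κ + t ≠ 0 := fun t ↦ slitPlane_ne_zero (add_ofReal_mem_slitPlane hκ0 t)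
  have hcont : Continuous fun t : ℝ ↦ -((κ + t) ^ 2)⁻¹ :=
    (((continuous_const.add Complex.continuous_ofReal).pow 2).inv₀ fun t ↦ pow_ne_zero 2 (hne t)).neg
  -- the composite trapezoid rule for `f(x) = log(κ + x)` with step `h = 1/n`
  have htrap := Literature.Analysis.Calculus.norm_trapezoid_sum_le (E := ℂ) (f := fun t : ℝ ↦ log (κ + t))
    (f' := fun t : ℝ ↦ (κ + t)⁻¹) (f'' := fun t : ℝ ↦ -((κ + t) ^ 2)⁻¹) (a := a) (ζ := 1 / δ ^ 2)
    hh0 N (fun x _ ↦ hasDerivAt_log_add_ofReal hκ0 x) (fun x _ ↦ hasDerivAt_inv_add_ofReal hκ0 x)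
    hcont.continuousOn (fun x _ ↦ norm_inv_sq_add_ofReal_le hδ hκ x)
  -- identify the grid points and rescale by `n`
  have hgrid : ∀ i : ℕ, a + i * h = ((A : ℝ) + i) / n := fun i ↦ by
    rw [ha, hh]; field_simp
  simp_rw [hgrid] at htrap
  -- multiply the trapezoid estimate by `n`
  have hscale : (n : ℂ) * (h • (∑ i ∈ range (N + 1), log (κ + (((A : ℝ) + i) / n : ℝ))) -
      (h / 2) • (log (κ + (a : ℝ)) + log (κ + (((A : ℝ) + N) / n : ℝ))) -
      ∫ x in a..(((A : ℝ) + N) / n), log (κ + x)) =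
      (∑ i ∈ range (N + 1), log (κ + (((A : ℝ) + i) / n : ℝ))) -
        (1 / 2 : ℂ) * (log (κ + ((A : ℝ) / n : ℝ)) + log (κ + (((A : ℝ) + N) / n : ℝ))) -
        (n : ℂ) * ∫ x in ((A : ℝ) / n)..(((A : ℝ) + N) / n), log (κ + x) := by
    rw [hh, ha]
    simp only [Complex.real_smul]
    have hn0 : (n : ℂ) ≠ 0 := by exact_mod_cast hn.ne'
    push_cast
    field_simp
  rw [← hscale, norm_mul, Complex.norm_natCast]
  calc (n : ℝ) * ‖h • (∑ i ∈ range (N + 1), log (κ + (((A : ℝ) + i) / n : ℝ))) -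
        (h / 2) • (log (κ + (a : ℝ)) + log (κ + (((A : ℝ) + N) / n : ℝ))) -
        ∫ x in a..(((A : ℝ) + N) / n), log (κ + x)‖
      ≤ n * (N * (1 / δ ^ 2 * h ^ 3 / 12)) := mul_le_mul_of_nonneg_left htrap hn'.le
    _ = N / (12 * (n : ℝ) ^ 2 * δ ^ 2) := by
        rw [hh]; field_simp

end Literature.Analysis.SpecialFunctions
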